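import Summits.QuantumFields.BalabanUV.T4Continuum.Support.VectorBlockTrialForm

/-!
# T⁴ programme, spine node NE2 (U1a), lane P2 — SUPPLIER LEAF V-UB, COVARIANT DRESSING: the tilted trial 1-form pulled back by contractive right inverses of
# the line transports meets the TRANSPORTED (1.18) constraint EXACTLY, and its covariant ROUGH Dirichlet form is `≤ 2d·(60·6^{d−1})²·((2 + n w)² + 9)·Σ‖φ‖²`
# — a k-UNIFORM upper bound for the vector block-spin value of ANY first-order form dominated by the rough form (model level, `E`-valued, transports DATA)

NE2 formalisation swarm `b2b-balaban-t4-ne2-formalise-*`, leaf 03 GEN 4 (`prover-b2b-balaban-t4-ne2-formalise-leaf-03-g4-0`); file 2 of the V-UB line (journal INTENT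
CLAIMS.log 2026-08-20 ≈10:31Z), on top of file 1 `Support/VectorBlockTrialForm` (the spill-free tilted trial form `trialV`, `QvV_trialV : Q_v ψ_φ = κ • φ`,
`kappaV_bounds`) and of V-COL-UB's `VariationalColourUpperBound.{cov_diff_split, norm_cov_diff_le, norm_defect_le_two}` (the one algebraic point, BY NAME).

THE STATEMENT (row V-UB of `t4/skeletons/NE2-t4-ne2-p2.md` §2.E «X8(U)(B) ≤ Λ_V·nsq B directly at every level», here for the ROUGH form; model level).
Level `n = L^k`; `E` any normed ℂ-space; 1-forms `W : Tor (fine n M) → Fin d → E`, data `φ : Tor M → Fin d → E`.  DATA: line transports `T_l(x,μ) : E →L[ℂ] E`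
(bringing the bond variable at `(x, μ)` to the block frame inside the line-sum average; indexed by the BOND — the printed one-step averaging [B7] (125) ∕
[B9] (3.13)–(3.15) indexes it by the LINE (start and position); the two agree at flat background and are O(α)-close in the small-field class: located note
N-ne2leaf03g4-1; the line-indexed carrier `QvL` and its V-UB are the sequels `VectorLineTransport*`) with right inverses `S_l(x,μ)`
(`T_l∘S_l = 1`, `‖T_l‖, ‖S_l‖ ≤ 1`), parallel transports `R(x,ν) : E →L[ℂ] E` along the bond `(x, x+e_ν)` (`‖R‖ ≤ 1`), and the IN-BLOCK defect
    `‖R(x,ν) ∘ S_l(x+e_ν, μ) ∘ T_l(x, μ) − 1‖ ≤ w`   for bonds `(x, x+e_ν)` with BOTH ends in one block, all components `μ`      (hw)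
(for contour transports of a background with plaquette defect `a`: `w ≲ d·n·a`, k-uniform under the class `n²a ≤ c`; NO hypothesis across blocks).
 * §0 `nsqV φ := Σ_{y,μ}‖φ(y,μ)‖²`; §1 `norm_trialV_le` (`‖ψ_φ‖ ≤ ‖φ‖`, `≤ ‖φ‖/n` on EVERY entry face incl. the tilt direction: `b(0)·|a| ≤ 1/n`);
 * §2 `abs_bumpW_step_le`, **`abs_weight_step_le`** (`|n·Δ_ν(W·a)| ≤ 2`: Leibniz in the tilt direction, `|nΔb| ≤ 1`, `|nΔa| = 1`), **`norm_step_trialV_le`**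
   (`‖n•(ψ_φ(x+e_ν,μ) − ψ_φ(x,μ))‖ ≤ 2‖φ(y,μ)‖ + ‖φ(y+e_ν,μ)‖`, in-block and across faces);
 * §3 the TRANSPORTED average `QvT n M Tl W y μ := n^{−(d+1)} • Σ_j Σ_t T_l(p,μ)(W(p,μ))` (at `T_l = 1`: file 1's `QvV` = `QvOp`), the competitor
   `compV Sl φ x μ := S_l(x,μ)(κ⁻¹ • ψ_φ(x,μ))`, **`QvT_compV : Q_T (compV S_l φ) = φ`** EXACTLY (`T_l∘S_l = 1` + `QvV_trialV` + `κ > 0`);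
 * §4 **`norm_bondV_le`**: `‖R(x,ν)(λ_φ(x+e_ν,μ)) − λ_φ(x,μ)‖ ≤ (κ⁻¹/n)·((2 + n·w)‖φ(y,μ)‖ + 3‖φ(y+e_ν,μ)‖)`;
 * §5 `roughV R W := Σ_{ν,μ,x}‖R(x,ν)(W(x+e_ν,μ)) − W(x,μ)‖²`, **`sq_mul_roughV_compV_le`** (`n²·rough ≤ 2dκ⁻²((2+nw)²+9)·n^d·Σ‖φ‖²`),
   **`physRoughV_compV_le`** (`n^{2−d}·rough ≤ 2d(60·6^{d−1})²((2+nw)²+9)·Σ‖φ‖²`, via `κ⁻¹ ≤ 60·6^{d−1}`), **`blockSpin_vector_le`** (P2's type-generic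
   `VariationalTransfer.blockSpin` over the fibre of `QvT`), `exists_ubV_phys`.
WHY ROUGH: the curl form `Σ‖D_νW_μ − D_μW_ν‖²` ([B9] (3.3)–(3.4)) and a divergence∕gauge term are sums of squares of differences of the SAME covariant first
differences, hence `≤ const·rough` by Cauchy–Schwarz; `blockSpin` is monotone in the form (`VariationalTransfer.blockSpin_mono`), so the owner's V-D form, once
fixed, inherits this bound with its own constant — nothing about that form is decided here.

HONEST FRAMING (T4-DAG p. 1).  Model level; transporters DATA (continuous linear maps, no group structure, no identification with Bałaban's `U(Γ)` — c5); the
bound `w ≲ d·n·a` for contour transports is a separate geometric leaf (leaf-04-g2's taxi files, U(1)); [folklore] lattice calculus; nothing printed is a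
hypothesis; data `def`s `nsqV`, `QvT`, `compV`, `roughV`, no `def … : Prop`, no `sorry`; axioms standard.  NE2 NOT proved; spine 0/9; rung (B)+1 finite T⁴ —
NOT infinite volume, NOT mass gap, NOT Clay.  HONEST DEPENDENCY (cell, verbatim): continuum YM on T⁴ ⇐ BetaPertH ∧ nine spine estimates (0/9 proved); BetaPertH ⇐
(D1) ∧ (D4) ∧ CAP+tail; G-an2-4 gates asym, D1 and NE2/3/4.
-/

noncomputable section

namespace Summit.QuantumFields.BalabanUV.T4Continuum.VectorBlockTrialForm

open Finset
open scoped ComplexConjugate Matrix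
open Literature.MathematicalPhysics.QuantumFieldTheory.Balaban1983to89
open Literature.MathematicalPhysics.QuantumFieldTheory.Balaban1983to89.B5Prop11Plancherel (Tor fine unitVec)
open Literature.MathematicalPhysics.QuantumFieldTheory.Balaban1983to89.B5Block118 (tstep bpt)
open Literature.MathematicalPhysics.QuantumFieldTheory.Balaban1983to89.B5AverageCurlStokes (sum_blocks_real)
open Literature.MathematicalPhysics.QuantumFieldTheory.Balaban1983to89.B5Blocks16 (blockOf blockOf_bpt)
open Summit.QuantumFields.BalabanUV.T4Continuum.ScalarBlockTrialFunction
  (digits digits_bpt bump bump_mem bump_face abs_bump_step_le beta1 beta1_ge bumpW bumpW_mem bumpW_update prod_erase_mem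
   bpt_add_unitVec_of_lt bpt_add_unitVec_of_eq)
open Summit.QuantumFields.BalabanUV.T4Continuum.VariationalColourUpperBound (nsqv nsqv_nonneg)

variable {d : ℕ} (n : ℕ) [NeZero n] (M : Fin d → ℕ) [hM : ∀ μ, NeZero (M μ)]
variable {E : Type*} [NormedAddCommGroup E]

/-! ## §0 The `ℓ²` size of unit-lattice 1-forms -/

/-- the `ℓ²` size of a unit-lattice 1-form, `Σ_y Σ_μ ‖φ(y,μ)‖²`. [folklore] -/
def nsqV (φ : Tor M → Fin d → E) : ℝ := ∑ y, ∑ μ, ‖φ y μ‖ ^ 2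

/-- `0 ≤ Σ‖φ‖²`. [folklore] -/
theorem nsqV_nonneg (φ : Tor M → Fin d → E) : 0 ≤ nsqV M φ := sum_nonneg fun _ _ => sum_nonneg fun _ _ => by positivity

variable [NormedSpace ℂ E]

/-! ## §1 Values of the tilted trial form: `≤ ‖φ‖` everywhere, `≤ ‖φ‖/n` on EVERY entry face (also in the tilt direction) -/

/-- `‖ψ_φ(n·y+j, μ)‖ ≤ ‖φ(y, μ)‖` and, on the entry face of direction `ν` (`j_ν = 0`), `‖ψ_φ‖ ≤ ‖φ(y,μ)‖/n` — for `ν ≠ μ` by the bump factor `b(0) = 1/n`,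
for `ν = μ` by `b(0)·|a(0)| ≤ 1/n`. [folklore] -/
theorem norm_trialV_le (φ : Tor M → Fin d → E) (y : Tor M) (j : Fin d → Fin n) (μ ν : Fin d) :
    ‖trialV n M φ (bpt n M y j) μ‖ ≤ ‖φ y μ‖ ∧ ‖trialV n M φ (bpt n M y (Function.update j ν 0)) μ‖ ≤ ‖φ y μ‖ / n := by
  have hn0 : (0 : ℝ) < n := by exact_mod_cast Nat.pos_of_ne_zero (NeZero.ne n)
  constructor
  · rw [trialV_bpt, norm_smul, Complex.norm_real, Real.norm_eq_abs]
    exact mul_le_of_le_one_left (norm_nonneg _) (abs_weight_le_one n j μ)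
  · rw [trialV_bpt, norm_smul, Complex.norm_real, Real.norm_eq_abs]
    -- `|W(j[ν↦0])·a(·)| ≤ 1/n`
    have hw : |bumpW n (Function.update j ν 0) * tilt n ((Function.update j ν 0) μ)| ≤ 1 / n := by
      obtain ⟨hR0, hR1⟩ := prod_erase_mem n j ν
      have hW : bumpW n (Function.update j ν 0) = bump n ((0 : Fin n) : ℕ) * ∏ κ ∈ Finset.univ.erase ν, bump n (j κ) :=
        (bumpW_update n j ν 0).1
      have hface : bump n ((0 : Fin n) : ℕ) = 1 / n := by
        have hpred : (n - 1) + 1 = n := Nat.sub_add_cancel (Nat.pos_of_ne_zero (NeZero.ne n))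
        rw [Fin.val_zero]; exact (bump_face n (n - 1) hpred).2
      have ha : |tilt n ((Function.update j ν 0) μ)| ≤ 1 := abs_tilt_le_one _ ((Function.update j ν 0) μ).is_lt
      rw [abs_mul, hW, hface, abs_of_nonneg (by positivity)]
      calc 1 / (n : ℝ) * (∏ κ ∈ Finset.univ.erase ν, bump n (j κ)) * |tilt n ((Function.update j ν 0) μ)|
          ≤ 1 / (n : ℝ) * 1 * 1 := by
            refine mul_le_mul (mul_le_mul_of_nonneg_left hR1 (by positivity)) ha (abs_nonneg _) (by positivity)
        _ = 1 / n := by ring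
    calc |bumpW n (Function.update j ν 0) * tilt n ((Function.update j ν 0) μ)| * ‖φ y μ‖ ≤ 1 / n * ‖φ y μ‖ :=
        mul_le_mul_of_nonneg_right hw (norm_nonneg _)
      _ = ‖φ y μ‖ / n := by ring

/-! ## §2 In-block steps of the tilted weights: `|n·Δ_ν(W·a)| ≤ 2` -/

/-- the product bump alone: `|n·(W(j[ν ↦ j_ν+1]) − W(j))| ≤ 1` inside the block (leaf-09's `abs_bump_step_le` on the `ν`-factor). [folklore] -/
theorem abs_bumpW_step_le (j : Fin d → Fin n) (ν : Fin d) (h : (j ν : ℕ) + 1 < n) :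
    |(n : ℝ) * (bumpW n (Function.update j ν ⟨(j ν : ℕ) + 1, h⟩) - bumpW n j)| ≤ 1 := by
  obtain ⟨hR0, hR1⟩ := prod_erase_mem n j ν
  rw [(bumpW_update n j ν _).1, (bumpW_update n j ν 0).2]
  have e : (n : ℝ) * (bump n ((j ν : ℕ) + 1) * ∏ κ ∈ Finset.univ.erase ν, bump n (j κ) - bump n (j ν) * ∏ κ ∈ Finset.univ.erase ν, bump n (j κ))
      = ((n : ℝ) * (bump n ((j ν : ℕ) + 1) - bump n (j ν))) * ∏ κ ∈ Finset.univ.erase ν, bump n (j κ) := by ring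
  rw [e, abs_mul, abs_of_nonneg hR0]
  exact mul_le_one₀ (abs_bump_step_le n (j ν) h) hR0 hR1

/-- **the tilted weight's in-block steps**: `|n·(W(j′)a(j′_μ) − W(j)a(j_μ))| ≤ 2` for `j′ = j[ν ↦ j_ν + 1]` inside the block — for `ν ≠ μ` the tilt factor is
unchanged (`≤ 1·1`), for `ν = μ` Leibniz: `|nΔW|·|a| + W·|nΔa| ≤ 1 + 1`. [folklore] -/
theorem abs_weight_step_le (j : Fin d → Fin n) (μ ν : Fin d) (h : (j ν : ℕ) + 1 < n) :
    |(n : ℝ) * (bumpW n (Function.update j ν ⟨(j ν : ℕ) + 1, h⟩) * tilt n ((Function.update j ν ⟨(j ν : ℕ) + 1, h⟩) μ)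
        - bumpW n j * tilt n (j μ))| ≤ 2 := by
  have hn : 0 < n := Nat.zero_lt_of_lt h
  set j' := Function.update j ν ⟨(j ν : ℕ) + 1, h⟩ with hj'
  have hW := abs_bumpW_step_le n j ν h
  have hWm := bumpW_mem n j
  have hW'm := bumpW_mem n j'
  have ha : |tilt n (j μ)| ≤ 1 := abs_tilt_le_one _ (j μ).is_lt
  have ha' : |tilt n (j' μ)| ≤ 1 := abs_tilt_le_one _ (j' μ).is_lt
  by_cases hμ : μ = ν
  · subst hμ
    have hjμ : (j' μ : ℕ) = (j μ : ℕ) + 1 := by rw [hj', Function.update_self]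
    have hstep : (n : ℝ) * (tilt n (j' μ) - tilt n (j μ)) = 1 := by rw [hjμ]; exact tilt_step hn (j μ)
    -- Leibniz
    have e : (n : ℝ) * (bumpW n j' * tilt n (j' μ) - bumpW n j * tilt n (j μ))
        = ((n : ℝ) * (bumpW n j' - bumpW n j)) * tilt n (j' μ) + bumpW n j * ((n : ℝ) * (tilt n (j' μ) - tilt n (j μ))) := by ring
    rw [e, hstep, mul_one]
    calc |(n : ℝ) * (bumpW n j' - bumpW n j) * tilt n (j' μ) + bumpW n j|
        ≤ |(n : ℝ) * (bumpW n j' - bumpW n j) * tilt n (j' μ)| + |bumpW n j| := abs_add_le _ _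
      _ ≤ 1 * 1 + 1 := by
          rw [abs_mul, abs_of_nonneg hWm.1]
          exact add_le_add (mul_le_mul hW ha' (abs_nonneg _) zero_le_one) hWm.2
      _ = 2 := by norm_num
  · have hjμ : j' μ = j μ := by rw [hj', Function.update_of_ne hμ]
    rw [hjμ]
    have e : (n : ℝ) * (bumpW n j' * tilt n (j μ) - bumpW n j * tilt n (j μ)) = ((n : ℝ) * (bumpW n j' - bumpW n j)) * tilt n (j μ) := by ring
    rw [e, abs_mul]
    calc |(n : ℝ) * (bumpW n j' - bumpW n j)| * |tilt n (j μ)| ≤ 1 * 1 := mul_le_mul hW ha (abs_nonneg _) zero_le_one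
      _ ≤ 2 := by norm_num

/-- **one-step differences of the trial form**: `‖n • (ψ_φ(x + e_ν, μ) − ψ_φ(x, μ))‖ ≤ 2‖φ(y,μ)‖ + ‖φ(y+e_ν, μ)‖` at `x = n·y + j` — inside the block by the
weight step `≤ 2`, across the face both values are `≤ ‖φ‖/n`. [folklore] -/
theorem norm_step_trialV_le (φ : Tor M → Fin d → E) (y : Tor M) (j : Fin d → Fin n) (μ ν : Fin d) :
    ‖(n : ℂ) • (trialV n M φ (bpt n M y j + unitVec (fine n M) ν) μ - trialV n M φ (bpt n M y j) μ)‖ ≤ 2 * ‖φ y μ‖ + ‖φ (y + unitVec M ν) μ‖ := by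
  have hn0 : (0 : ℝ) < n := by exact_mod_cast Nat.pos_of_ne_zero (NeZero.ne n)
  by_cases h : (j ν : ℕ) + 1 < n
  · -- inside the block
    rw [bpt_add_unitVec_of_lt n M y j ν h, trialV_bpt, trialV_bpt, ← sub_smul, smul_smul, norm_smul]
    have e : (n : ℂ) * (((bumpW n (Function.update j ν ⟨(j ν : ℕ) + 1, h⟩) * tilt n ((Function.update j ν ⟨(j ν : ℕ) + 1, h⟩) μ) : ℝ) : ℂ)
        - ((bumpW n j * tilt n (j μ) : ℝ) : ℂ))
        = (((n : ℝ) * (bumpW n (Function.update j ν ⟨(j ν : ℕ) + 1, h⟩) * tilt n ((Function.update j ν ⟨(j ν : ℕ) + 1, h⟩) μ)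
            - bumpW n j * tilt n (j μ)) : ℝ) : ℂ) := by push_cast; ring
    rw [e, Complex.norm_real, Real.norm_eq_abs]
    calc _ ≤ 2 * ‖φ y μ‖ := mul_le_mul_of_nonneg_right (abs_weight_step_le n j μ ν h) (norm_nonneg _)
      _ ≤ 2 * ‖φ y μ‖ + ‖φ (y + unitVec M ν) μ‖ := by linarith [norm_nonneg (φ (y + unitVec M ν) μ)]
  · -- across the face: exit value and entry value are both ≤ ‖φ‖/n
    have heq : (j ν : ℕ) + 1 = n := by have := (j ν).is_lt; omega
    have hexit : ‖trialV n M φ (bpt n M y j) μ‖ ≤ ‖φ y μ‖ / n := by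
      -- `j_ν = n − 1`: the bump factor `b(n−1) = 1/n`
      rw [trialV_bpt, norm_smul, Complex.norm_real, Real.norm_eq_abs]
      obtain ⟨hR0, hR1⟩ := prod_erase_mem n j ν
      have hb : bump n (j ν) = 1 / n := (bump_face n (j ν) heq).1
      have ha : |tilt n (j μ)| ≤ 1 := abs_tilt_le_one _ (j μ).is_lt
      rw [(bumpW_update n j ν 0).2, hb, abs_mul, abs_of_nonneg (by positivity)]
      calc 1 / (n : ℝ) * (∏ κ ∈ Finset.univ.erase ν, bump n (j κ)) * |tilt n (j μ)| * ‖φ y μ‖ ≤ 1 / (n : ℝ) * 1 * 1 * ‖φ y μ‖ := by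
            refine mul_le_mul_of_nonneg_right ?_ (norm_nonneg _)
            exact mul_le_mul (mul_le_mul_of_nonneg_left hR1 (by positivity)) ha (abs_nonneg _) (by positivity)
        _ = ‖φ y μ‖ / n := by ring
    have hentry := (norm_trialV_le n M φ (y + unitVec M ν) j μ ν).2
    rw [bpt_add_unitVec_of_eq n M y j ν heq, norm_smul, Complex.norm_natCast]
    calc (n : ℝ) * ‖trialV n M φ (bpt n M (y + unitVec M ν) (Function.update j ν 0)) μ - trialV n M φ (bpt n M y j) μ‖
        ≤ (n : ℝ) * (‖φ (y + unitVec M ν) μ‖ / n + ‖φ y μ‖ / n) :=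
          mul_le_mul_of_nonneg_left ((norm_sub_le _ _).trans (add_le_add hentry hexit)) hn0.le
      _ = ‖φ (y + unitVec M ν) μ‖ + ‖φ y μ‖ := by field_simp
      _ ≤ 2 * ‖φ y μ‖ + ‖φ (y + unitVec M ν) μ‖ := by linarith [norm_nonneg (φ y μ)]

/-! ## §3 The TRANSPORTED line-sum average and the competitor `S_l·(κ⁻¹ • ψ_φ)` meeting the constraint EXACTLY -/

/-- **the TRANSPORTED (1.18) line-sum average**: `(Q_T W)(y,μ) = n^{−(d+1)} • Σ_j Σ_{t<n} T_l(p, μ)(W(p, μ))`, `p = n·y + j + t e_μ` — every bond variable on the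
straight lines is brought to the block frame by a transport `T_l(p, μ) : E →L[ℂ] E` (DATA, indexed by the BOND; a MODEL of the main term of
[Balaban1985AveragingOperations] (125) ∕ [Balaban1985BackgroundPropagators] (3.13)–(3.15) p.393, whose transport is indexed by the LINE (start, position) — equal at
flat background, O(α)-close in the small-field class (located note N-ne2leaf03g4-1; line-indexed carrier: `VectorLineTransport.QvL`); at `T_l = 1` the U = 1 average
`QvV`, (1.18)). [folklore] -/
def QvT (Tl : Tor (fine n M) → Fin d → (E →L[ℂ] E)) (W : Tor (fine n M) → Fin d → E) (y : Tor M) (μ : Fin d) : E :=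
  (((n : ℂ) ^ (d + 1))⁻¹ : ℂ) • ∑ j : Fin d → Fin n, ∑ t : Fin n, Tl (bpt n M y j + tstep (fine n M) μ t) μ (W (bpt n M y j + tstep (fine n M) μ t) μ)

/-- **THE COMPETITOR** `λ_φ(x, μ) := S_l(x, μ)(κ⁻¹ • ψ_φ(x, μ))` — the tilted trial form, normalised, pulled back by right inverses `S_l` of the line transports. [folklore] -/
def compV (Sl : Tor (fine n M) → Fin d → (E →L[ℂ] E)) (φ : Tor M → Fin d → E) (x : Tor (fine n M)) (μ : Fin d) : E :=
  Sl x μ ((((kappaV d n)⁻¹ : ℝ) : ℂ) • trialV n M φ x μ)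

/-- **CONSTRAINT, EXACTLY**: `Q_T λ_φ = φ` whenever `T_l(x,μ) ∘ S_l(x,μ) = 1` — the transports cancel bond by bond and `Q_v ψ_φ = κ • φ` (file 1). [folklore] -/
theorem QvT_compV {Tl Sl : Tor (fine n M) → Fin d → (E →L[ℂ] E)} (hTS : ∀ x μ v, Tl x μ (Sl x μ v) = v) (φ : Tor M → Fin d → E) :
    QvT n M Tl (compV n M Sl φ) = φ := by
  funext y μ
  have hd : 1 ≤ d := Nat.succ_le_of_lt (Fin.pos μ)
  have hn : 0 < n := Nat.pos_of_ne_zero (NeZero.ne n)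
  have hκ : ((kappaV d n : ℝ) : ℂ) ≠ 0 := by exact_mod_cast (kappaV_pos hd hn).ne'
  have h := congrFun (congrFun (QvV_trialV n M φ) y) μ
  unfold QvV at h
  unfold QvT compV
  simp_rw [hTS, ← Finset.smul_sum]
  rw [smul_comm, h, smul_smul]
  have e : (((kappaV d n)⁻¹ : ℝ) : ℂ) * ((kappaV d n : ℝ) : ℂ) = 1 := by
    push_cast; exact inv_mul_cancel₀ hκ
  rw [e, one_smul]

/-! ## §4 The covariant bond-wise bound for the competitor -/

/-- **BOND-WISE BOUND** at `x = n·y + j`, step direction `ν`, component `μ`: with contractive parallel transports `R(x,ν)`, line transports `T_l` with contractive right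
inverses `S_l`, and the IN-BLOCK defect `‖R(x,ν) ∘ S_l(x+e_ν,μ) ∘ T_l(x,μ) − 1‖ ≤ w` (both ends of the bond in one block):
`‖R(x,ν)(λ_φ(x+e_ν,μ)) − λ_φ(x,μ)‖ ≤ (κ⁻¹/n)·((2 + n·w)·‖φ(y,μ)‖ + 3·‖φ(y+e_ν,μ)‖)` — in-block bonds pay `w` on `‖ψ‖ ≤ ‖φ(y)‖`, face bonds pay `2` on the face
value `‖φ(y+e_ν)‖/n`; the plain difference is `norm_step_trialV_le`; the split is V-COL-UB's `cov_diff_split` (only `T_l∘S_l = 1`). [folklore] -/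
theorem norm_bondV_le {Tl Sl : Tor (fine n M) → Fin d → (E →L[ℂ] E)} (hTS : ∀ x μ v, Tl x μ (Sl x μ v) = v) (hT : ∀ x μ, ‖Tl x μ‖ ≤ 1)
    (hS : ∀ x μ, ‖Sl x μ‖ ≤ 1) {R : Tor (fine n M) → Fin d → (E →L[ℂ] E)} (hR : ∀ x ν, ‖R x ν‖ ≤ 1) {w : ℝ} (hw0 : 0 ≤ w)
    (hw : ∀ (y : Tor M) (j : Fin d → Fin n) (ν μ : Fin d), (j ν : ℕ) + 1 < n →
      ‖R (bpt n M y j) ν * Sl (bpt n M y j + unitVec (fine n M) ν) μ * Tl (bpt n M y j) μ - 1‖ ≤ w)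
    (φ : Tor M → Fin d → E) (y : Tor M) (j : Fin d → Fin n) (ν μ : Fin d) :
    ‖R (bpt n M y j) ν (compV n M Sl φ (bpt n M y j + unitVec (fine n M) ν) μ) - compV n M Sl φ (bpt n M y j) μ‖
      ≤ (kappaV d n)⁻¹ / n * ((2 + n * w) * ‖φ y μ‖ + 3 * ‖φ (y + unitVec M ν) μ‖) := by
  have hd : 1 ≤ d := Nat.succ_le_of_lt (Fin.pos μ)
  have hn : 0 < n := Nat.pos_of_ne_zero (NeZero.ne n)
  set c : ℝ := (kappaV d n)⁻¹ with hc
  have hc0 : 0 < c := inv_pos.mpr (kappaV_pos hd hn)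
  have hn0 : (0 : ℝ) < n := by exact_mod_cast hn
  have hn' : (n : ℝ) ≠ 0 := hn0.ne'
  have hsplit := VariationalColourUpperBound.norm_cov_diff_le n M (T := fun z => Tl z μ) (S := fun z => Sl z μ) (fun z v => hTS z μ v) (fun z => hS z μ)
    (R (bpt n M y j) ν) (fun z => ((c : ℝ) : ℂ) • trialV n M φ z μ) (bpt n M y j) (bpt n M y j + unitVec (fine n M) ν)
  unfold compV
  beta_reduce at hsplit
  -- the plain difference
  have hstep : ‖((c : ℝ) : ℂ) • trialV n M φ (bpt n M y j + unitVec (fine n M) ν) μ - ((c : ℝ) : ℂ) • trialV n M φ (bpt n M y j) μ‖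
      ≤ c / n * (2 * ‖φ y μ‖ + ‖φ (y + unitVec M ν) μ‖) := by
    have h := norm_step_trialV_le n M φ y j μ ν
    rw [norm_smul, Complex.norm_natCast] at h
    have h' : ‖trialV n M φ (bpt n M y j + unitVec (fine n M) ν) μ - trialV n M φ (bpt n M y j) μ‖ ≤ (2 * ‖φ y μ‖ + ‖φ (y + unitVec M ν) μ‖) / n := by
      rw [le_div_iff₀ hn0, mul_comm]; exact h
    rw [← smul_sub, norm_smul, Complex.norm_real, Real.norm_of_nonneg hc0.le]
    calc c * ‖trialV n M φ (bpt n M y j + unitVec (fine n M) ν) μ - trialV n M φ (bpt n M y j) μ‖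
        ≤ c * ((2 * ‖φ y μ‖ + ‖φ (y + unitVec M ν) μ‖) / n) := mul_le_mul_of_nonneg_left h' hc0.le
      _ = c / n * (2 * ‖φ y μ‖ + ‖φ (y + unitVec M ν) μ‖) := by ring
  have hφ0 : 0 ≤ ‖φ y μ‖ := norm_nonneg _
  have hφ1 : 0 ≤ ‖φ (y + unitVec M ν) μ‖ := norm_nonneg _
  by_cases hlt : (j ν : ℕ) + 1 < n
  · -- IN-BLOCK bond
    have hv := hw y j ν μ hlt
    have hgx' : ‖((c : ℝ) : ℂ) • trialV n M φ (bpt n M y j + unitVec (fine n M) ν) μ‖ ≤ c * ‖φ y μ‖ := by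
      rw [bpt_add_unitVec_of_lt n M y j ν hlt, norm_smul, Complex.norm_real, Real.norm_of_nonneg hc0.le]
      exact mul_le_mul_of_nonneg_left (norm_trialV_le n M φ y _ μ ν).1 hc0.le
    calc _ ≤ _ := hsplit
      _ ≤ c / n * (2 * ‖φ y μ‖ + ‖φ (y + unitVec M ν) μ‖) + w * (c * ‖φ y μ‖) :=
          add_le_add hstep (mul_le_mul hv hgx' (norm_nonneg _) hw0)
      _ = c / n * ((2 + n * w) * ‖φ y μ‖ + ‖φ (y + unitVec M ν) μ‖) := by field_simp; ring
      _ ≤ c / n * ((2 + n * w) * ‖φ y μ‖ + 3 * ‖φ (y + unitVec M ν) μ‖) := by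
          refine mul_le_mul_of_nonneg_left ?_ (by positivity); linarith
  · -- FACE bond
    have heq : (j ν : ℕ) + 1 = n := by have := (j ν).is_lt; omega
    have hv : ‖R (bpt n M y j) ν * Sl (bpt n M y j + unitVec (fine n M) ν) μ * Tl (bpt n M y j) μ - 1‖ ≤ 2 :=
      VariationalColourUpperBound.norm_defect_le_two n M (T := fun z => Tl z μ) (S := fun z => Sl z μ) (fun z => hT z μ) (fun z => hS z μ) (hR _ ν) _ _
    have hgx' : ‖((c : ℝ) : ℂ) • trialV n M φ (bpt n M y j + unitVec (fine n M) ν) μ‖ ≤ c * (‖φ (y + unitVec M ν) μ‖ / n) := by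
      rw [bpt_add_unitVec_of_eq n M y j ν heq, norm_smul, Complex.norm_real, Real.norm_of_nonneg hc0.le]
      exact mul_le_mul_of_nonneg_left (norm_trialV_le n M φ (y + unitVec M ν) j μ ν).2 hc0.le
    have hnw : 0 ≤ n * w := by positivity
    calc _ ≤ _ := hsplit
      _ ≤ c / n * (2 * ‖φ y μ‖ + ‖φ (y + unitVec M ν) μ‖) + 2 * (c * (‖φ (y + unitVec M ν) μ‖ / n)) :=
          add_le_add hstep (mul_le_mul hv hgx' (norm_nonneg _) (by norm_num))
      _ = c / n * (2 * ‖φ y μ‖ + 3 * ‖φ (y + unitVec M ν) μ‖) := by field_simp; ring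
      _ ≤ c / n * ((2 + n * w) * ‖φ y μ‖ + 3 * ‖φ (y + unitVec M ν) μ‖) := by
          refine mul_le_mul_of_nonneg_left ?_ (by positivity); nlinarith

/-! ## §5 Summing over bonds: the covariant ROUGH Dirichlet form of the competitor, the block-spin reading, the `∃`-form -/

/-- the covariant ROUGH Dirichlet form of an `E`-valued 1-form: `Σ_ν Σ_μ Σ_x ‖R(x,ν)(W(x+e_ν, μ)) − W(x, μ)‖²` — every covariant first difference of every
component (it dominates the curl form `Σ‖D_νW_μ − D_μW_ν‖² ≤ 2·rough` and the divergence∕gauge term; lattice units; transports `R` DATA). [folklore] -/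
def roughV (R : Tor (fine n M) → Fin d → (E →L[ℂ] E)) (W : Tor (fine n M) → Fin d → E) : ℝ :=
  ∑ ν, ∑ μ, ∑ x, ‖R x ν (W (x + unitVec (fine n M) ν) μ) - W x μ‖ ^ 2

/-- `0 ≤ rough`. [folklore] -/
theorem roughV_nonneg (R : Tor (fine n M) → Fin d → (E →L[ℂ] E)) (W : Tor (fine n M) → Fin d → E) : 0 ≤ roughV n M R W :=
  sum_nonneg fun _ _ => sum_nonneg fun _ _ => sum_nonneg fun _ _ => by positivity

/-- **LEAF V-UB (lattice units)**: `n²·rough_R(λ_φ) ≤ 2d·κ⁻²·((2 + n·w)² + 9)·n^d·Σ_{y,μ}‖φ(y,μ)‖²`. [folklore] -/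
theorem sq_mul_roughV_compV_le {Tl Sl : Tor (fine n M) → Fin d → (E →L[ℂ] E)} (hTS : ∀ x μ v, Tl x μ (Sl x μ v) = v) (hT : ∀ x μ, ‖Tl x μ‖ ≤ 1)
    (hS : ∀ x μ, ‖Sl x μ‖ ≤ 1) {R : Tor (fine n M) → Fin d → (E →L[ℂ] E)} (hR : ∀ x ν, ‖R x ν‖ ≤ 1) {w : ℝ} (hw0 : 0 ≤ w)
    (hw : ∀ (y : Tor M) (j : Fin d → Fin n) (ν μ : Fin d), (j ν : ℕ) + 1 < n →
      ‖R (bpt n M y j) ν * Sl (bpt n M y j + unitVec (fine n M) ν) μ * Tl (bpt n M y j) μ - 1‖ ≤ w)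
    (φ : Tor M → Fin d → E) :
    (n : ℝ) ^ 2 * roughV n M R (compV n M Sl φ) ≤ 2 * d * ((kappaV d n)⁻¹) ^ 2 * ((2 + n * w) ^ 2 + 9) * ((n : ℝ) ^ d * nsqV M φ) := by
  set c : ℝ := (kappaV d n)⁻¹ with hc
  have hn0 : (0 : ℝ) < n := by exact_mod_cast Nat.pos_of_ne_zero (NeZero.ne n)
  have hcard : (Fintype.card (Fin d → Fin n) : ℝ) = (n : ℝ) ^ d := by
    rw [Fintype.card_fun, Fintype.card_fin, Fintype.card_fin]; push_cast; ring
  have hshift : ∀ ν μ : Fin d, ∑ y : Tor M, ‖φ (y + unitVec M ν) μ‖ ^ 2 = ∑ y : Tor M, ‖φ y μ‖ ^ 2 := fun ν μ =>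
    Fintype.sum_equiv (Equiv.addRight (unitVec M ν)) _ _ fun y => rfl
  -- per step direction `ν` and component `μ`
  have hνμ : ∀ ν μ : Fin d, (n : ℝ) ^ 2 * ∑ x, ‖R x ν (compV n M Sl φ (x + unitVec (fine n M) ν) μ) - compV n M Sl φ x μ‖ ^ 2
      ≤ 2 * c ^ 2 * ((2 + n * w) ^ 2 + 9) * ((n : ℝ) ^ d * ∑ y : Tor M, ‖φ y μ‖ ^ 2) := by
    intro ν μ
    rw [sum_blocks_real n M (fun x => ‖R x ν (compV n M Sl φ (x + unitVec (fine n M) ν) μ) - compV n M Sl φ x μ‖ ^ 2)]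
    have hpt : ∀ (y : Tor M) (j : Fin d → Fin n),
        (n : ℝ) ^ 2 * ‖R (bpt n M y j) ν (compV n M Sl φ (bpt n M y j + unitVec (fine n M) ν) μ) - compV n M Sl φ (bpt n M y j) μ‖ ^ 2
          ≤ 2 * c ^ 2 * ((2 + n * w) ^ 2 * ‖φ y μ‖ ^ 2 + 9 * ‖φ (y + unitVec M ν) μ‖ ^ 2) := by
      intro y j
      have h := norm_bondV_le n M hTS hT hS hR hw0 hw φ y j ν μ
      have h2 := pow_le_pow_left₀ (norm_nonneg _) h 2
      have e : (n : ℝ) ^ 2 * (c / n * ((2 + n * w) * ‖φ y μ‖ + 3 * ‖φ (y + unitVec M ν) μ‖)) ^ 2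
          = c ^ 2 * ((2 + n * w) * ‖φ y μ‖ + 3 * ‖φ (y + unitVec M ν) μ‖) ^ 2 := by field_simp
      have h3 : ((2 + n * w) * ‖φ y μ‖ + 3 * ‖φ (y + unitVec M ν) μ‖) ^ 2
          ≤ 2 * ((2 + n * w) ^ 2 * ‖φ y μ‖ ^ 2 + 9 * ‖φ (y + unitVec M ν) μ‖ ^ 2) := by
        nlinarith [sq_nonneg ((2 + n * w) * ‖φ y μ‖ - 3 * ‖φ (y + unitVec M ν) μ‖)]
      calc _ ≤ (n : ℝ) ^ 2 * (c / n * ((2 + n * w) * ‖φ y μ‖ + 3 * ‖φ (y + unitVec M ν) μ‖)) ^ 2 := mul_le_mul_of_nonneg_left h2 (by positivity)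
        _ = c ^ 2 * ((2 + n * w) * ‖φ y μ‖ + 3 * ‖φ (y + unitVec M ν) μ‖) ^ 2 := e
        _ ≤ _ := by nlinarith [h3, sq_nonneg c]
    rw [mul_sum]
    calc ∑ y : Tor M, (n : ℝ) ^ 2 * ∑ j : Fin d → Fin n,
          ‖R (bpt n M y j) ν (compV n M Sl φ (bpt n M y j + unitVec (fine n M) ν) μ) - compV n M Sl φ (bpt n M y j) μ‖ ^ 2
        ≤ ∑ y : Tor M, ∑ _j : Fin d → Fin n, 2 * c ^ 2 * ((2 + n * w) ^ 2 * ‖φ y μ‖ ^ 2 + 9 * ‖φ (y + unitVec M ν) μ‖ ^ 2) := by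
          refine sum_le_sum fun y _ => ?_
          rw [mul_sum]
          exact sum_le_sum fun j _ => hpt y j
      _ = ∑ y : Tor M, ((n : ℝ) ^ d * (2 * c ^ 2 * (2 + n * w) ^ 2) * ‖φ y μ‖ ^ 2 + (n : ℝ) ^ d * (2 * c ^ 2 * 9) * ‖φ (y + unitVec M ν) μ‖ ^ 2) := by
          simp only [sum_const, card_univ, nsmul_eq_mul, hcard]
          exact sum_congr rfl fun y _ => by ring
      _ = 2 * c ^ 2 * ((2 + n * w) ^ 2 + 9) * ((n : ℝ) ^ d * ∑ y : Tor M, ‖φ y μ‖ ^ 2) := by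
          rw [sum_add_distrib, ← mul_sum, ← mul_sum, hshift ν μ]; ring
  unfold roughV nsqV
  rw [mul_sum]
  calc ∑ ν, (n : ℝ) ^ 2 * ∑ μ, ∑ x, ‖R x ν (compV n M Sl φ (x + unitVec (fine n M) ν) μ) - compV n M Sl φ x μ‖ ^ 2
      ≤ ∑ _ν : Fin d, ∑ μ, 2 * c ^ 2 * ((2 + n * w) ^ 2 + 9) * ((n : ℝ) ^ d * ∑ y : Tor M, ‖φ y μ‖ ^ 2) := by
        refine sum_le_sum fun ν _ => ?_
        rw [mul_sum]
        exact sum_le_sum fun μ _ => hνμ ν μ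
    _ = 2 * d * c ^ 2 * ((2 + n * w) ^ 2 + 9) * ((n : ℝ) ^ d * ∑ y, ∑ μ, ‖φ y μ‖ ^ 2) := by
        rw [sum_const, card_univ, Fintype.card_fin, nsmul_eq_mul, Finset.sum_comm, ← mul_sum, ← mul_sum]; ring

/-- **LEAF V-UB (physical units, explicit k-UNIFORM constant)**: `n^{2−d}·rough_R(λ_φ) ≤ 2d·(60·6^{d−1})²·((2 + n w)² + 9)·Σ_{y,μ}‖φ(y,μ)‖²` — the rough covariant
Dirichlet action of the competitor in the normalisation `n^{2−d}·Σ` against the unit-lattice `ℓ²` size of the datum. [folklore] -/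
theorem physRoughV_compV_le {Tl Sl : Tor (fine n M) → Fin d → (E →L[ℂ] E)} (hTS : ∀ x μ v, Tl x μ (Sl x μ v) = v) (hT : ∀ x μ, ‖Tl x μ‖ ≤ 1)
    (hS : ∀ x μ, ‖Sl x μ‖ ≤ 1) {R : Tor (fine n M) → Fin d → (E →L[ℂ] E)} (hR : ∀ x ν, ‖R x ν‖ ≤ 1) {w : ℝ} (hw0 : 0 ≤ w)
    (hw : ∀ (y : Tor M) (j : Fin d → Fin n) (ν μ : Fin d), (j ν : ℕ) + 1 < n →
      ‖R (bpt n M y j) ν * Sl (bpt n M y j + unitVec (fine n M) ν) μ * Tl (bpt n M y j) μ - 1‖ ≤ w)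
    (hd : 1 ≤ d) (φ : Tor M → Fin d → E) :
    ((n : ℝ) ^ d)⁻¹ * ((n : ℝ) ^ 2 * roughV n M R (compV n M Sl φ)) ≤ 2 * d * (60 * (6 : ℝ) ^ (d - 1)) ^ 2 * ((2 + n * w) ^ 2 + 9) * nsqV M φ := by
  have hn : 0 < n := Nat.pos_of_ne_zero (NeZero.ne n)
  have hn0 : (0 : ℝ) < (n : ℝ) ^ d := by positivity
  have h := sq_mul_roughV_compV_le n M hTS hT hS hR hw0 hw φ
  obtain ⟨hκ, -⟩ := kappaV_bounds hd hn
  have hκ0 := kappaV_pos hd hn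
  have hc : (kappaV d n)⁻¹ ≤ 60 * (6 : ℝ) ^ (d - 1) := by
    rw [inv_le_comm₀ hκ0 (by positivity)]
    calc (60 * (6 : ℝ) ^ (d - 1))⁻¹ = ((1 : ℝ) / 6) ^ (d - 1) / 60 := by rw [one_div, inv_pow]; ring
      _ ≤ kappaV d n := hκ
  have hc2 : ((kappaV d n)⁻¹) ^ 2 ≤ (60 * (6 : ℝ) ^ (d - 1)) ^ 2 := pow_le_pow_left₀ (inv_nonneg.mpr hκ0.le) hc 2
  have hφ := nsqV_nonneg M φ
  rw [inv_mul_le_iff₀ hn0]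
  calc _ ≤ 2 * d * ((kappaV d n)⁻¹) ^ 2 * ((2 + n * w) ^ 2 + 9) * ((n : ℝ) ^ d * nsqV M φ) := h
    _ ≤ 2 * d * (60 * (6 : ℝ) ^ (d - 1)) ^ 2 * ((2 + n * w) ^ 2 + 9) * ((n : ℝ) ^ d * nsqV M φ) := by gcongr
    _ = _ := by ring

/-- **LEAF V-UB (block-spin reading)**: for ANY first-order form `S ≤ rough_R` (curl, curl + gauge term, …) the constrained minimum over the fibre of the TRANSPORTED
line-sum average obeys `blockSpin (Q_T) (n^{2−d}·rough_R) φ ≤ 2d·(60·6^{d−1})²·((2 + n·w)² + 9)·Σ‖φ‖²` — k-UNIFORM (the level enters only through `n·w`), every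
torus, every `E`; binders: `T_l∘S_l = 1`, `‖T_l‖, ‖S_l‖, ‖R‖ ≤ 1` and the IN-BLOCK defect `w`; no global frame. [folklore] -/
theorem blockSpin_vector_le {Tl Sl : Tor (fine n M) → Fin d → (E →L[ℂ] E)} (hTS : ∀ x μ v, Tl x μ (Sl x μ v) = v) (hT : ∀ x μ, ‖Tl x μ‖ ≤ 1)
    (hS : ∀ x μ, ‖Sl x μ‖ ≤ 1) {R : Tor (fine n M) → Fin d → (E →L[ℂ] E)} (hR : ∀ x ν, ‖R x ν‖ ≤ 1) {w : ℝ} (hw0 : 0 ≤ w)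
    (hw : ∀ (y : Tor M) (j : Fin d → Fin n) (ν μ : Fin d), (j ν : ℕ) + 1 < n →
      ‖R (bpt n M y j) ν * Sl (bpt n M y j + unitVec (fine n M) ν) μ * Tl (bpt n M y j) μ - 1‖ ≤ w)
    (hd : 1 ≤ d) (φ : Tor M → Fin d → E) :
    VariationalTransfer.blockSpin (QvT n M Tl) (fun W => ((n : ℝ) ^ d)⁻¹ * ((n : ℝ) ^ 2 * roughV n M R W)) φ
      ≤ 2 * d * (60 * (6 : ℝ) ^ (d - 1)) ^ 2 * ((2 + n * w) ^ 2 + 9) * nsqV M φ := by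
  have hSn : ∀ W : Tor (fine n M) → Fin d → E, 0 ≤ ((n : ℝ) ^ d)⁻¹ * ((n : ℝ) ^ 2 * roughV n M R W) := fun W => by
    have := roughV_nonneg n M R W
    positivity
  exact (VariationalTransfer.blockSpin_le hSn (QvT_compV n M hTS φ)).trans (physRoughV_compV_le n M hTS hT hS hR hw0 hw hd φ)

/-- **LEAF V-UB, `∃`-form, physical units**: `∃ W, Q_T W = φ ∧ n^{2−d}·rough_R(W) ≤ 2d·(60·6^{d−1})²·((2 + n·w)² + 9)·Σ‖φ‖²` — the shape of an upper-bound binder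
for the vector assembly. [folklore] -/
theorem exists_ubV_phys {Tl Sl : Tor (fine n M) → Fin d → (E →L[ℂ] E)} (hTS : ∀ x μ v, Tl x μ (Sl x μ v) = v) (hT : ∀ x μ, ‖Tl x μ‖ ≤ 1)
    (hS : ∀ x μ, ‖Sl x μ‖ ≤ 1) {R : Tor (fine n M) → Fin d → (E →L[ℂ] E)} (hR : ∀ x ν, ‖R x ν‖ ≤ 1) {w : ℝ} (hw0 : 0 ≤ w)
    (hw : ∀ (y : Tor M) (j : Fin d → Fin n) (ν μ : Fin d), (j ν : ℕ) + 1 < n →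
      ‖R (bpt n M y j) ν * Sl (bpt n M y j + unitVec (fine n M) ν) μ * Tl (bpt n M y j) μ - 1‖ ≤ w)
    (hd : 1 ≤ d) :
    ∀ φ : Tor M → Fin d → E, ∃ W : Tor (fine n M) → Fin d → E, QvT n M Tl W = φ ∧
      ((n : ℝ) ^ d)⁻¹ * ((n : ℝ) ^ 2 * roughV n M R W) ≤ 2 * d * (60 * (6 : ℝ) ^ (d - 1)) ^ 2 * ((2 + n * w) ^ 2 + 9) * nsqV M φ :=
  fun φ => ⟨_, QvT_compV n M hTS φ, physRoughV_compV_le n M hTS hT hS hR hw0 hw hd φ⟩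

end Summit.QuantumFields.BalabanUV.T4Continuum.VectorBlockTrialForm

end
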